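import Mathlib
import Summits.ResolutionOfSingularities.ResolutionOfSingularities.Theorems.WeightedInvariantLocalWeightedDropTOT2BridgePresByStep
import Summits.ResolutionOfSingularities.ResolutionOfSingularities.Theorems.WeightedInvariantLocalWeightedDropNCGameBWinsDefs

/-!
# `WeightedInvariant.LocalWeightedDrop` ENGINE, W′|₄ line — D₃ᴮ object (3): THE ONE-STEPS OF REGIME (P) IN B-PERMISSIBLE FORM (HAND A)

Sub-problem `ResolutionOfSingularities`, ENGINE crux `stmt-ResolutionOfSingularities-8899` (`LocalWeightedDrop`), registered stub W′|₄
`stub_wildWideApexFourStartsWon`; res-L1-w43-plan-1 RULING 2026-08-27T21:45:42Z (D₃ᴮ lane) — the one-step hypotheses `hP2'` / `hP2c'` of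
`regimeLetterB_of_pieces` (…NCResRegimeLetterAssemblyB) for the lazy selector `prepSelWP`.  [OURS · L1 W4.3 · chain w43 · res-L1-w43-lead-1 g6; def-free;
the proofs of `Decoration.PresBy.moveClause_point` / `exists_move_point` / `exists_move_of_not_conflict` (…TOT2BridgePresByStep, res-L1-w43-stub-2)
RE-THREADED: there the successor decorations were ALREADY the transforms `δ.transform Φ w c i` and the moves ALREADY B-permissible
(`Decoration.PresBy` records `IsBPermissible δ Θ 𝟙`; `isBPermissible_curve_of_presentation` for the curve moves) — the count-move interface merely forgot
both.  Nothing here is a statement of any manuscript; AI-produced, gate-checked, weaker than expert review.]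

* `Decoration.PresBy.bmoveClause_point` — the point move `(Θ, 𝟙)` satisfies the B-move clause towards «order drop, or same head RECORDED by a
  well-prepared member of the lazy point family»;
* `Decoration.PresBy.exists_bmove_point` — `hP2c'` of `regimeLetterB_of_pieces` at `ψsel := prepSelWP`;
* `Decoration.PresBy.exists_bmove_of_not_conflict` — `hP2'` of `regimeLetterB_of_pieces` at `ψsel := prepSelWP`;
* `presBy_hP2B_prepSelWP` / `presBy_hP2cB_prepSelWP` — the same under the hypothesis binders.
-/

set_option linter.dupNamespace false -- mandated namespace of this single-conjunct summit

noncomputable section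

namespace Summit.ResolutionOfSingularities.ResolutionOfSingularities.Theorems

namespace TameFourTupleDrop

open MvPowerSeries Literature.AlgebraicGeometry.Resolution

variable {k : Type} [Field k]

section Steps

variable {b : MvPowerSeries (Fin (2 + 1)) k} {δ : Decoration k 2} {Θ : Fin (2 + 1) → MvPowerSeries (Fin (2 + 1)) k} {d : ℕ}
  {A : Fin d → MvPowerSeries (Fin 2) k} {N : Finset (Fin 2)}

/-- **THE POINT MOVE READ THROUGH THE RECORD, B-PERMISSIBLE FORM** (`k` algebraically closed): from a recorded state of the polygon regime the point
move `(Θ, 𝟙)` (B-permissible by the record) is answered, at every answer, at some live slot, by THE TRANSFORM of the decoration, admissible, which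
drops the order, or keeps the head and is RECORDED by a well-prepared member of the lazy point family `PointFamilySel d (prepSelWP d) A N`.  The
proof is that of `Decoration.PresBy.moveClause_point` (whose successor witnesses ARE the transforms), re-threaded. -/
theorem Decoration.PresBy.bmoveClause_point [IsAlgClosed k] (hadm : Admissible b δ) (ho : 2 ≤ δ.o) (hcd : δ.c = d)
    (h : δ.PresBy d A N Θ) (hin : PolyDescent.InPoly d A) :
    BMoveClause (b, δ) Θ (fun _ => 1)
      (fun τ' => Admissible τ'.1 τ'.2 ∧ ((τ'.2.o < δ.o) ∨ (τ'.2.head = δ.head ∧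
        ∃ (A' : Fin d → MvPowerSeries (Fin 2) k) (N' : Finset (Fin 2)) (Θ' : Fin (2 + 1) → MvPowerSeries (Fin (2 + 1)) k),
          τ'.2.PresBy d A' N' Θ' ∧ PolyDescent.WellPrepared d A' ∧ PolyDescent.PointFamilySel d (PolyDescent.prepSelWP d) A N A' N'))) := by
  classical
  have hd : 0 < d := Decoration.pos_of_c_eq ho hcd
  obtain ⟨U, hU, hP⟩ := h.exists_eq
  have hperm₁ := h.1
  have hf : δ.f ≠ 0 := hadm.2.1.ne_zero
  intro pt hconv hpt Aexp G hfac hG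
  by_cases hγ : pt (Fin.last 2) = 0
  · by_cases hc0 : pt 0 = 0
    · -- slot `u₂`: label `blowTwo A`, boundary `insert 1 (N.filter (· = 0))`
      have hc1 : pt 1 ≠ 0 := pointAnswer_one_ne_zero hpt hγ hc0
      have hc1' : pt (Fin.castSucc 1) ≠ 0 := hc1
      have hc0' : pt (Fin.castSucc 0) = 0 := hc0
      have hadm' := admissible_transform hadm hperm₁ hconv hfac hG hc1'
      by_cases hlt : (δ.transform Θ (fun _ => 1) pt (Fin.castSucc 1)).o < δ.o
      · exact ⟨Fin.castSucc 1, hc1', hadm', Or.inl hlt⟩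
      · have heq := h.head_transform_eq_of_not_lt hperm₁ hconv hf hc1' hγ hlt
        have hnear := Decoration.o_transform_eq_of_head_eq' heq
        obtain ⟨Θ', H', hperm', hax, hΘ'l, hH', hP'⟩ :=
          Decoration.presentation_pointSucc_one_axes hperm₁ hf hU hin.2.1 hP hγ hc0 hc1 hnear
        exact ⟨Fin.castSucc 1, hc1', hadm', Or.inr ⟨heq, PolyDescent.blowTwoT d A, insert 1 (N.filter fun l => l = 0), Θ',
          h.transform_one heq hc1' hc0' hperm' hax hΘ'l hc1 hH' hP', PolyDescent.wellPrepared_blowTwoT A hin.2.1 hin.1,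
          Or.inr (Or.inr ⟨rfl, rfl⟩)⟩⟩
    · -- slot `u₁`
      have hc0' : pt (Fin.castSucc 0) ≠ 0 := hc0
      have hadm' := admissible_transform hadm hperm₁ hconv hfac hG hc0'
      by_cases hlt : (δ.transform Θ (fun _ => 1) pt (Fin.castSucc 0)).o < δ.o
      · exact ⟨Fin.castSucc 0, hc0', hadm', Or.inl hlt⟩
      · have heq := h.head_transform_eq_of_not_lt hperm₁ hconv hf hc0' hγ hlt
        have hnear := Decoration.o_transform_eq_of_head_eq' heq
        obtain ⟨Θ', H', hperm', hax, hΘ'l, hH', hP'⟩ :=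
          Decoration.presentation_pointSucc_zero_axes hperm₁ hf hU hin.2.1 hP hγ hc0 hnear
        refine ⟨Fin.castSucc 0, hc0', hadm', Or.inr ⟨heq, ?_⟩⟩
        by_cases hc1 : pt 1 = 0
        · -- origin of the `u₁`-chart: label `blowOne A`, boundary `insert 0 (N.filter (· = 1))`
          have hsh : PolyDescent.shearT (C (pt 1 / pt 0)) A = A := by
            rw [hc1, zero_div, map_zero]; exact PolyDescent.shearT_zero A
          rw [hsh] at hP'
          have hc1' : pt (Fin.castSucc 1) = 0 := hc1
          exact ⟨PolyDescent.blowOneT d A, insert 0 (N.filter fun l => l = 1), Θ',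
            h.transform_zero_of_eq_zero heq hc0' hc1' hperm' hax hΘ'l hc0 hH' hP', PolyDescent.wellPrepared_blowOneT A hin.2.1 hin.1,
            Or.inl ⟨rfl, rfl⟩⟩
        · -- translated point: label `blowOne (shear_λ A)` lazily prepared, boundary `{0}`
          have hl : pt 1 / pt 0 ≠ 0 := div_ne_zero hc1 hc0
          have hc1' : pt (Fin.castSucc 1) ≠ 0 := hc1
          set Y := PolyDescent.shearT (C (pt 1 / pt 0)) A with hY
          have hposY : PolyDescent.IsPosT d Y := PolyDescent.isPosT_shearT _ hin.2.1
          have hpres' := h.transform_zero_of_ne_zero heq hc0' hc1' hperm' hax hΘ'l hc0 hH' hP'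
          by_cases hWPY : PolyDescent.WellPrepared d Y
          · refine ⟨PolyDescent.blowOneT d Y, {0}, Θ', hpres', PolyDescent.wellPrepared_blowOneT Y hposY hWPY,
              Or.inr (Or.inl ⟨pt 1 / pt 0, hl, ?_, rfl⟩)⟩
            rw [← hY, PolyDescent.prepSelWP_of_wellPrepared hWPY, WildMonic.shift_zero]
          · obtain ⟨hχ0, hposB, hWPB, -⟩ := PolyDescent.isPrepRecentring_prepSelWP (PolyDescent.stub_polyPrep k d hd) hposY
            set χ := PolyDescent.prepSelWP d Y with hχ
            have hχ1 : (1 : ℕ∞) ≤ χ.order := nat_le_order fun e he => by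
              have he0 : e = 0 := by
                have : e.degree = 0 := by exact_mod_cast Nat.lt_one_iff.mp (by exact_mod_cast he)
                exact (Finsupp.degree_eq_zero_iff e).mp this
              rw [he0, coeff_zero_eq_constantCoeff_apply, hχ0]
            have hcomm := PolyDescent.blowOneT_shift Y _ (fun j => (hposY j).le) hχ1
            have hchi1 : constantCoeff (MonicDescent.blowOne 1 χ) = 0 := by
              rw [MonicDescent.constantCoeff_blowOne_one_eq]
              exact PolyDescent.coeff_single_one_eq_zero_of_isPosT_shift hd hposY hχ0 hposB 0
            have hO : δ.O = ∅ := h.O_eq_empty_of_not_wellPrepared_shearT hd _ hWPY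
            have hO' := Decoration.O_transform_eq_empty_of_head_eq heq hO
            obtain ⟨Θ'', hpres''⟩ := hpres'.recentre hO' hchi1
            refine ⟨_, {0}, Θ'', hpres'', ?_, Or.inr (Or.inl ⟨pt 1 / pt 0, hl, ?_, rfl⟩)⟩
            · rw [← hcomm]; exact PolyDescent.wellPrepared_blowOneT _ hposB hWPB
            · rw [← hcomm]
  · -- far answer: the order letter drops to `0`
    have hγ0 : pt (Fin.last 2) ≠ 0 := hγ
    have hadm' := admissible_transform hadm hperm₁ hconv hfac hG hγ0
    refine ⟨Fin.last 2, hγ0, hadm', Or.inl ?_⟩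
    rw [o_transform_eq_zero_of_gamma_ne_zero hperm₁ hf hU hin.2.1 hP hγ0 (Fin.last 2)]
    omega

/-- **(P2c)ᴮ THE POINT MOVE AT A RECORDED STATE, B-PERMISSIBLE FORM** — in the interface of `regimeLetterB_of_pieces` (`hP2c'`). -/
theorem Decoration.PresBy.exists_bmove_point [IsAlgClosed k] (hadm : Admissible b δ) (ho : 2 ≤ δ.o) (hcd : δ.c = d)
    (h : δ.PresBy d A N Θ) (hin : PolyDescent.InPoly d A) :
    ∃ (Φ : Fin (2 + 1) → MvPowerSeries (Fin (2 + 1)) k) (w : Fin (2 + 1) → ℕ), IsBPermissible δ Φ w ∧ BMoveClause (b, δ) Φ w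
      (fun τ' => Admissible τ'.1 τ'.2 ∧ ((τ'.2.o < δ.o) ∨ (τ'.2.head = δ.head ∧
        ∃ (A' : Fin d → MvPowerSeries (Fin 2) k) (N' : Finset (Fin 2)) (Θ' : Fin (2 + 1) → MvPowerSeries (Fin (2 + 1)) k),
          τ'.2.PresBy d A' N' Θ' ∧ PolyDescent.WellPrepared d A' ∧ PolyDescent.PointFamilySel d (PolyDescent.prepSelWP d) A N A' N'))) :=
  ⟨Θ, _, h.1, h.bmoveClause_point hadm ho hcd hin⟩

/-- **(P2)ᴮ THE STRATEGY MOVE OFF THE CONFLICT AT A RECORDED STATE, B-PERMISSIBLE FORM** (`k` algebraically closed) — in the interface of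
`regimeLetterB_of_pieces` (`hP2'`): some B-PERMISSIBLE move is answered, at every answer, at some live slot, by THE TRANSFORM, admissible, which drops
the order, or keeps the head and is RECORDED by a well-prepared family successor `SuccFamilySel d (prepSelWP d) A N A′ N′` of the lazy strategy. -/
theorem Decoration.PresBy.exists_bmove_of_not_conflict [IsAlgClosed k] (hadm : Admissible b δ) (ho : 2 ≤ δ.o) (hcd : δ.c = d)
    (h : δ.PresBy d A N Θ) (hin : PolyDescent.InPoly d A) (hnc : ¬ NCPoly.Conflict d A N) :
    ∃ (Φ : Fin (2 + 1) → MvPowerSeries (Fin (2 + 1)) k) (w : Fin (2 + 1) → ℕ), IsBPermissible δ Φ w ∧ BMoveClause (b, δ) Φ w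
      (fun τ' => Admissible τ'.1 τ'.2 ∧ ((τ'.2.o < δ.o) ∨ (τ'.2.head = δ.head ∧
        ∃ (A' : Fin d → MvPowerSeries (Fin 2) k) (N' : Finset (Fin 2)) (Θ' : Fin (2 + 1) → MvPowerSeries (Fin (2 + 1)) k),
          τ'.2.PresBy d A' N' Θ' ∧ PolyDescent.WellPrepared d A' ∧ PolyDescent.SuccFamilySel d (PolyDescent.prepSelWP d) A N A' N'))) := by
  classical
  have hd : 0 < d := Decoration.pos_of_c_eq ho hcd
  obtain ⟨U, hU, hP⟩ := h.exists_eq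
  have hperm₁ := h.1
  have hf : δ.f ≠ 0 := hadm.2.1.ne_zero
  by_cases h1 : PolyDescent.IsPermissibleOneT d A
  · -- curve `V(y,u₁)`
    have hdiv : ∀ j, A j = X 0 ^ (d - (j : ℕ)) * PolyDescent.divOneT d A j := fun j => PolyDescent.eq_X_pow_mul_divOneT h1 j
    have hpermw := isBPermissible_curve_of_presentation hperm₁ hf 0 hdiv hU hP
    refine ⟨Θ, _, hpermw, ?_⟩
    intro pt hconv hpt Aexp G hfac hG
    by_cases hγ : pt (Fin.last 2) = 0
    · have hc0 := castSucc_ne_zero_of_curveAnswer 0 hconv hpt hγ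
      have hc1 : pt (Fin.castSucc 1) = 0 := hconv (Fin.castSucc 1) (by simp)
      have hadm' := admissible_transform hadm hpermw hconv hfac hG hc0
      refine ⟨Fin.castSucc 0, hc0, hadm', ?_⟩
      by_cases hlt : (δ.transform Θ (fun l : Fin (2 + 1) => if l = Fin.castSucc 0 ∨ l = Fin.last 2 then (1 : ℕ) else 0) pt
          (Fin.castSucc 0)).o < δ.o
      · exact Or.inl hlt
      · have heq := h.head_transform_eq_of_not_lt hpermw hconv hf hc0 hγ hlt
        have hnear := Decoration.o_transform_eq_of_head_eq' heq
        obtain ⟨Θ', H', hperm', hax, hΘ'l, hH', hP'⟩ :=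
          Decoration.presentation_curveSucc_zero_axes hperm₁ hf hU hdiv hP hconv hγ hc0 hnear
        exact Or.inr ⟨heq, PolyDescent.divOneT d A, insert 0 (N.filter fun l => l = 1), Θ',
          h.transform_zero_of_eq_zero heq hc0 hc1 hperm' hax hΘ'l hc0 hH' hP', PolyDescent.wellPrepared_divOneT A h1 hin.1,
          Or.inl ⟨h1, rfl, rfl⟩⟩
    · have hγ0 : pt (Fin.last 2) ≠ 0 := hγ
      have hadm' := admissible_transform hadm hpermw hconv hfac hG hγ0
      refine ⟨Fin.last 2, hγ0, hadm', Or.inl ?_⟩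
      rw [o_transform_curve_eq_zero_of_gamma_ne_zero' hperm₁ hf hU hin.2.1 hP hdiv hconv hγ0 (Fin.last 2)]
      omega
  by_cases h2 : PolyDescent.IsPermissibleTwoT d A
  · -- curve `V(y,u₂)`
    have hdiv : ∀ j, A j = X 1 ^ (d - (j : ℕ)) * PolyDescent.divTwoT d A j := fun j => PolyDescent.eq_X_pow_mul_divTwoT h2 j
    have hpermw := isBPermissible_curve_of_presentation hperm₁ hf 1 hdiv hU hP
    refine ⟨Θ, _, hpermw, ?_⟩
    intro pt hconv hpt Aexp G hfac hG
    by_cases hγ : pt (Fin.last 2) = 0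
    · have hc1 := castSucc_ne_zero_of_curveAnswer 1 hconv hpt hγ
      have hc0 : pt (Fin.castSucc 0) = 0 := hconv (Fin.castSucc 0) (by simp)
      have hadm' := admissible_transform hadm hpermw hconv hfac hG hc1
      refine ⟨Fin.castSucc 1, hc1, hadm', ?_⟩
      by_cases hlt : (δ.transform Θ (fun l : Fin (2 + 1) => if l = Fin.castSucc 1 ∨ l = Fin.last 2 then (1 : ℕ) else 0) pt
          (Fin.castSucc 1)).o < δ.o
      · exact Or.inl hlt
      · have heq := h.head_transform_eq_of_not_lt hpermw hconv hf hc1 hγ hlt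
        have hnear := Decoration.o_transform_eq_of_head_eq' heq
        obtain ⟨Θ', H', hperm', hax, hΘ'l, hH', hP'⟩ :=
          Decoration.presentation_curveSucc_one_axes hperm₁ hf hU hdiv hP hconv hγ hc1 hnear
        exact Or.inr ⟨heq, PolyDescent.divTwoT d A, insert 1 (N.filter fun l => l = 0), Θ',
          h.transform_one heq hc1 hc0 hperm' hax hΘ'l hc1 hH' hP', PolyDescent.wellPrepared_divTwoT A h2 hin.1,
          Or.inr (Or.inl ⟨h1, h2, rfl, rfl⟩)⟩
    · have hγ0 : pt (Fin.last 2) ≠ 0 := hγ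
      have hadm' := admissible_transform hadm hpermw hconv hfac hG hγ0
      refine ⟨Fin.last 2, hγ0, hadm', Or.inl ?_⟩
      rw [o_transform_curve_eq_zero_of_gamma_ne_zero' hperm₁ hf hU hin.2.1 hP hdiv hconv hγ0 (Fin.last 2)]
      omega
  by_cases h3 : PolyDescent.HasGraphCurveT d A
  · -- graph curve, off the conflict: shear, lazy preparation, curve `V(y,u₂)` in the new record
    have h1N : (1 : Fin 2) ∉ N := fun h1N => hnc ⟨h1, h2, h3, h1N⟩
    obtain ⟨ψ, -, -, hpermψ⟩ := PolyDescent.graphShearT_spec h3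
    set Y := PolyDescent.shearT (PolyDescent.graphShearT d A) A with hY
    have hposY : PolyDescent.IsPosT d Y := PolyDescent.isPosT_shearT _ hin.2.1
    obtain ⟨hχ0, hposB, hWPB, -⟩ := PolyDescent.isPrepRecentring_prepSelWP (PolyDescent.stub_polyPrep k d hd) hposY
    set B := WildMonic.shift d Y (PolyDescent.prepSelWP d Y) with hB
    have hpermB : PolyDescent.IsPermissibleTwoT d B := by
      refine PolyDescent.isPermissibleTwoT_of_wellPrepared_of_isPermissibleTwoT_shift hd hWPB
        (φ := ψ - PolyDescent.prepSelWP d Y) ?_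
      rw [hB, PolyDescent.shift_shift, sub_add_cancel]
      exact hpermψ
    obtain ⟨Θ₁, hpres₁⟩ := h.shear h1N (PolyDescent.graphShearT d A)
    have hpresB : ∃ Θ₂ : Fin (2 + 1) → MvPowerSeries (Fin (2 + 1)) k, δ.PresBy d B N Θ₂ := by
      by_cases hWPY : PolyDescent.WellPrepared d Y
      · refine ⟨Θ₁, ?_⟩
        rw [hB, PolyDescent.prepSelWP_of_wellPrepared hWPY, WildMonic.shift_zero]
        exact hpres₁
      · exact hpres₁.recentre (h.O_eq_empty_of_not_wellPrepared_shearT hd _ hWPY) hχ0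
    obtain ⟨Θ₂, hpres₂⟩ := hpresB
    obtain ⟨U₂, hU₂, hP₂⟩ := hpres₂.exists_eq
    have hdiv : ∀ j, B j = X 1 ^ (d - (j : ℕ)) * PolyDescent.divTwoT d B j := fun j => PolyDescent.eq_X_pow_mul_divTwoT hpermB j
    have hpermw := isBPermissible_curve_of_presentation hpres₂.1 hf 1 hdiv hU₂ hP₂
    refine ⟨Θ₂, _, hpermw, ?_⟩
    intro pt hconv hpt Aexp G hfac hG
    by_cases hγ : pt (Fin.last 2) = 0
    · have hc1 := castSucc_ne_zero_of_curveAnswer 1 hconv hpt hγ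
      have hc0 : pt (Fin.castSucc 0) = 0 := hconv (Fin.castSucc 0) (by simp)
      have hadm' := admissible_transform hadm hpermw hconv hfac hG hc1
      refine ⟨Fin.castSucc 1, hc1, hadm', ?_⟩
      by_cases hlt : (δ.transform Θ₂ (fun l : Fin (2 + 1) => if l = Fin.castSucc 1 ∨ l = Fin.last 2 then (1 : ℕ) else 0) pt
          (Fin.castSucc 1)).o < δ.o
      · exact Or.inl hlt
      · have heq := hpres₂.head_transform_eq_of_not_lt hpermw hconv hf hc1 hγ hlt
        have hnear := Decoration.o_transform_eq_of_head_eq' heq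
        obtain ⟨Θ', H', hperm', hax, hΘ'l, hH', hP'⟩ :=
          Decoration.presentation_curveSucc_one_axes hpres₂.1 hf hU₂ hdiv hP₂ hconv hγ hc1 hnear
        exact Or.inr ⟨heq, PolyDescent.divTwoT d B, insert 1 (N.filter fun l => l = 0), Θ',
          hpres₂.transform_one heq hc1 hc0 hperm' hax hΘ'l hc1 hH' hP', PolyDescent.wellPrepared_divTwoT B hpermB hWPB,
          Or.inr (Or.inr (Or.inl ⟨h1, h2, h3, h1N, rfl, rfl⟩))⟩
    · have hγ0 : pt (Fin.last 2) ≠ 0 := hγ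
      have hadm' := admissible_transform hadm hpermw hconv hfac hG hγ0
      refine ⟨Fin.last 2, hγ0, hadm', Or.inl ?_⟩
      rw [o_transform_curve_eq_zero_of_gamma_ne_zero' hpres₂.1 hf hU₂ hposB hP₂ hdiv hconv hγ0 (Fin.last 2)]
      omega
  · -- no curve: the point family
    refine ⟨Θ, _, hperm₁, (h.bmoveClause_point hadm ho hcd hin).mono fun τ' hτ' => ?_⟩
    obtain ⟨hadm', hor⟩ := hτ'
    refine ⟨hadm', hor.imp_right fun hsame => ⟨hsame.1, ?_⟩⟩
    obtain ⟨A', N', Θ', hpres', hWP', hpf⟩ := hsame.2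
    exact ⟨A', N', Θ', hpres', hWP', Or.inr (Or.inr (Or.inr ⟨h1, h2, h3, hpf⟩))⟩

end Steps

/-! ## Under the hypothesis binders of `regimeLetterB_of_pieces` -/

/-- **`hP2'` OF `regimeLetterB_of_pieces` FOR `ψsel d := PolyDescent.prepSelWP d`.** -/
theorem presBy_hP2B_prepSelWP [IsAlgClosed k] :
    ∀ (b : MvPowerSeries (Fin (2 + 1)) k) (δ : Decoration k 2) (d : ℕ) (A : Fin d → MvPowerSeries (Fin 2) k) (N : Finset (Fin 2))
      (Θ : Fin (2 + 1) → MvPowerSeries (Fin (2 + 1)) k),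
      Admissible b δ → 2 ≤ δ.o → δ.c = d → δ.PresBy d A N Θ → PolyDescent.InPoly d A → ¬ NCPoly.Conflict d A N →
      ∃ (Φ : Fin (2 + 1) → MvPowerSeries (Fin (2 + 1)) k) (w : Fin (2 + 1) → ℕ), IsBPermissible δ Φ w ∧
        BMoveClause (b, δ) Φ w (fun τ' => Admissible τ'.1 τ'.2 ∧ (τ'.2.o < δ.o ∨ (τ'.2.head = δ.head ∧
          ∃ (A' : Fin d → MvPowerSeries (Fin 2) k) (N' : Finset (Fin 2)) (Θ' : Fin (2 + 1) → MvPowerSeries (Fin (2 + 1)) k),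
            τ'.2.PresBy d A' N' Θ' ∧ PolyDescent.WellPrepared d A' ∧
              PolyDescent.SuccFamilySel d (PolyDescent.prepSelWP (k := k) d) A N A' N'))) :=
  fun _ _ _ _ _ _ hadm ho hcd h hin hnc => h.exists_bmove_of_not_conflict hadm ho hcd hin hnc

/-- **`hP2c'` OF `regimeLetterB_of_pieces` FOR `ψsel d := PolyDescent.prepSelWP d`** (the conflict hypothesis is not needed). -/
theorem presBy_hP2cB_prepSelWP [IsAlgClosed k] :
    ∀ (b : MvPowerSeries (Fin (2 + 1)) k) (δ : Decoration k 2) (d : ℕ) (A : Fin d → MvPowerSeries (Fin 2) k) (N : Finset (Fin 2))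
      (Θ : Fin (2 + 1) → MvPowerSeries (Fin (2 + 1)) k),
      Admissible b δ → 2 ≤ δ.o → δ.c = d → δ.PresBy d A N Θ → PolyDescent.InPoly d A → NCPoly.Conflict d A N →
      ∃ (Φ : Fin (2 + 1) → MvPowerSeries (Fin (2 + 1)) k) (w : Fin (2 + 1) → ℕ), IsBPermissible δ Φ w ∧
        BMoveClause (b, δ) Φ w (fun τ' => Admissible τ'.1 τ'.2 ∧ (τ'.2.o < δ.o ∨ (τ'.2.head = δ.head ∧
          ∃ (A' : Fin d → MvPowerSeries (Fin 2) k) (N' : Finset (Fin 2)) (Θ' : Fin (2 + 1) → MvPowerSeries (Fin (2 + 1)) k),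
            τ'.2.PresBy d A' N' Θ' ∧ PolyDescent.WellPrepared d A' ∧
              PolyDescent.PointFamilySel d (PolyDescent.prepSelWP (k := k) d) A N A' N'))) :=
  fun _ _ _ _ _ _ hadm ho hcd h hin _ => h.exists_bmove_point hadm ho hcd hin

end TameFourTupleDrop

end Summit.ResolutionOfSingularities.ResolutionOfSingularities.Theorems

end
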